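import Literature.Analysis.FluidPDE.LerayHopfDatumCongr
import Literature.Analysis.FluidPDE.NSStrongSolutions2D
import Literature.Analysis.FunctionSpaces.TorusTimeAverage

/-!
# Route TwoAndHalfD (AnomalousDissipation) — Leray–Hopf weak solutions under slicewise a.e.
# modification (support of item `ScalarLift2halfDR`, stmt-AnomalousDissipation-14983)

Helper file (everything proved). `lerayHopfOn_congr_slices`: if `u` is a Leray–Hopf weak
solution on `T^d × [0, T)` (`Literature.Analysis.FluidPDE.Torus.IsLerayHopfOn`, `T > 0`) and
`u' t = u t` almost everywhere on `T^d` for every `t ∈ [0, T]`, and `u'` has a measurable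
space–time lift, then `u'` is a Leray–Hopf weak solution with the same datum and force: every
clause of the structure is an (iterated) integral of slices or a spectral quantity of slices
(Fourier coefficients are integrals), hence blind to slicewise null modifications. Used to pass
the Leray–Hopf structure from the Galerkin limit `(V, Θ)∘π` of the 2½-D scheme to the lift
`(v, Θ)∘π` of the GIVEN planar velocity `v` (`V t = v t` a.e., by two-dimensional uniqueness).
Also the small congruence lemmas it rests on (spectral norms, weak incompressibility, pairings).
-/

noncomputable section

open MeasureTheory Set Filter Topology Function UnitAddTorus
open scoped ENNReal NNReal InnerProductSpace
open Literature.Analysis.FunctionSpaces Literature.Analysis.FunctionSpaces.Torus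
open Literature.Analysis.FluidPDE Literature.Analysis.FluidPDE.Torus

namespace Summit.AnomalousDissipation.AnomalousDissipation.Theorems

-- D-0017: single-problem summit ⇒ `Summit.AnomalousDissipation.AnomalousDissipation.…` by design.
set_option linter.dupNamespace false

/-! ## Pairings only see a.e.-classes -/

section Congr

variable {d : Type*} [Fintype d]

/-- Inner-product pairings only see the a.e.-class of the right factor. [folklore] -/
theorem integral_inner_congr_ae_right' {u u' w : UnitAddTorus d → EuclideanSpace ℝ d}
    (h : u' =ᵐ[volume] u) : ∫ x, ⟪w x, u' x⟫_ℝ = ∫ x, ⟪w x, u x⟫_ℝ := by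
  refine integral_congr_ae ?_
  filter_upwards [h] with x hx
  rw [hx]

end Congr

/-! ## H2: Leray–Hopf structure under slicewise a.e. modification -/

section LHCongr

variable {d : Type*} [Fintype d] [DecidableEq d] {T ν : ℝ}
  {f u u' : ℝ → UnitAddTorus d → EuclideanSpace ℝ d} {u₀ : UnitAddTorus d → EuclideanSpace ℝ d}

/-- **A forced weak Navier–Stokes solution modified slice by slice on null sets is a forced weak
solution** (same datum, same force), provided the modified field has a measurable space–time
lift: every conjunct is an iterated integral or an a.e.-in-time statement about slices. [folklore] -/
theorem isWeakNSSolutionForcedOn_congr_slices (hu : IsWeakNSSolutionForcedOn T ν f u₀ u)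
    (hae : ∀ t ∈ Icc 0 T, u' t =ᵐ[volume] u t)
    (hm : AEStronglyMeasurable (stLift u') (volume.restrict (Ioo 0 T ×ˢ univ))) :
    IsWeakNSSolutionForcedOn T ν f u₀ u' := by
  obtain ⟨-, h2, h3, h4⟩ := hu
  have haeI : ∀ t ∈ Ioo 0 T, u' t =ᵐ[volume] u t := fun t ht => hae t (Ioo_subset_Icc_self ht)
  refine ⟨hm, ?_, ?_, fun ψ hψ hdiv => ?_⟩
  · rw [setLIntegral_congr_fun measurableSet_Ioo fun t ht => lintegral_congr_ae
      ((haeI t ht).mono fun x hx => by rw [hx])]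
    exact h2
  · filter_upwards [h3, ae_restrict_mem measurableSet_Ioo] with t ht htI
    exact ht.congr_ae (haeI t htI).symm
  · have hI : (∫ t in Ioo 0 T, ∫ x, (⟪u' t x, Torus.timeDeriv ψ t x⟫_ℝ + ⟪u' t x, Torus.convect (u' t) (ψ t) x⟫_ℝ +
        ν * ⟪u' t x, Torus.laplacian (ψ t) x⟫_ℝ + ⟪f t x, ψ t x⟫_ℝ)) =
        ∫ t in Ioo 0 T, ∫ x, (⟪u t x, Torus.timeDeriv ψ t x⟫_ℝ + ⟪u t x, Torus.convect (u t) (ψ t) x⟫_ℝ +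
        ν * ⟪u t x, Torus.laplacian (ψ t) x⟫_ℝ + ⟪f t x, ψ t x⟫_ℝ) := by
      refine setIntegral_congr_fun measurableSet_Ioo fun t ht => integral_congr_ae ?_
      filter_upwards [haeI t ht] with x hx
      simp only [Torus.convect, hx]
    rw [hI]
    exact h4 ψ hψ hdiv

/-- **A Leray–Hopf weak solution modified slice by slice on null sets (for `t ∈ [0, T]`) is a
Leray–Hopf weak solution** with the same datum and force, provided the modified field has a
measurable space–time lift: the weak formulation, energy bounds, spectral `L²H¹` membership,
energy inequalities, weak continuity and strong attainment of the datum are all expressed through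
integrals of slices (the spectral quantities through Fourier coefficients). [folklore] -/
theorem lerayHopfOn_congr_slices (hu : IsLerayHopfOn T ν f u₀ u) (hT : 0 < T)
    (hae : ∀ t ∈ Icc 0 T, u' t =ᵐ[volume] u t)
    (hm : AEStronglyMeasurable (stLift u') (volume.restrict (Ioo 0 T ×ˢ univ))) :
    IsLerayHopfOn T ν f u₀ u' := by
  have haeI : ∀ t ∈ Ioo 0 T, u' t =ᵐ[volume] u t := fun t ht => hae t (Ioo_subset_Icc_self ht)
  -- slice-level transfers
  have hKE : ∀ t ∈ Icc 0 T, kineticEnergy (u' t) = kineticEnergy (u t) := fun t ht =>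
    kineticEnergy_congr_ae (hae t ht)
  have hG : ∀ t ∈ Icc 0 T, eGradNormSq (u' t) = eGradNormSq (u t) := fun t ht =>
    eGradNormSq_congr_ae (hae t ht)
  have hwork : ∀ t ∈ Icc 0 T, ∫ x, ⟪f t x, u' t x⟫_ℝ = ∫ x, ⟪f t x, u t x⟫_ℝ := fun t ht =>
    integral_inner_congr_ae_right' (hae t ht)
  have hD : ∀ s t, 0 ≤ s → t ≤ T →
      ∫⁻ τ in Ioo s t, eGradNormSq (u' τ) = ∫⁻ τ in Ioo s t, eGradNormSq (u τ) := fun s t hs ht =>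
    setLIntegral_congr_fun measurableSet_Ioo fun τ hτ => hG τ ⟨hs.trans hτ.1.le, hτ.2.le.trans ht⟩
  have hW : ∀ s t, 0 ≤ s → s ≤ t → t ≤ T →
      ∫ τ in s..t, ∫ x, ⟪f τ x, u' τ x⟫_ℝ = ∫ τ in s..t, ∫ x, ⟪f τ x, u τ x⟫_ℝ := by
    intro s t hs hst ht
    refine intervalIntegral.integral_congr fun τ hτ => ?_
    rw [uIcc_of_le hst] at hτ
    exact hwork τ ⟨hs.trans hτ.1, hτ.2.trans ht⟩
  refine
    { weak := isWeakNSSolutionForcedOn_congr_slices hu.weak hae hm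
      energy_bound := ?_
      memLp := fun t ht => (hu.memLp t ht).ae_eq (hae t ht).symm
      memL2Sobolev := ?_
      energy_ineq_zero := fun t ht => ?_
      energy_ineq_ae := ?_
      weak_continuous := fun w hw => ?_
      strong_initial := ?_ }
  · obtain ⟨C, hC⟩ := hu.energy_bound
    refine ⟨C, ?_⟩
    filter_upwards [hC, ae_restrict_mem measurableSet_Ioo] with t ht htI
    rwa [lintegral_congr_ae ((haeI t htI).mono fun x hx => by rw [hx])]
  · obtain ⟨h1, h2⟩ := hu.memL2Sobolev
    refine ⟨?_, ?_⟩
    · filter_upwards [h1, ae_restrict_mem measurableSet_Ioo] with t ht htI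
      exact (memSobolev_congr_ae (complexify_comp_congr_ae (haeI t htI))).2 ht
    · unfold eL2SobolevNorm at h2 ⊢
      rwa [setLIntegral_congr_fun measurableSet_Ioo fun t ht =>
        by rw [eSobolevNorm_congr_ae 1 (complexify_comp_congr_ae (haeI t ht))]]
  · rw [hKE t ht, hD 0 t le_rfl ht.2, hW 0 t le_rfl ht.1 ht.2]
    exact hu.energy_ineq_zero t ht
  · filter_upwards [hu.energy_ineq_ae, ae_restrict_mem measurableSet_Ioo] with s hs hsI t ht
    rw [hKE t ⟨hsI.1.le.trans ht.1, ht.2⟩, hKE s (Ioo_subset_Icc_self hsI), hD s t hsI.1.le ht.2,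
      hW s t hsI.1.le ht.1 ht.2]
    exact hs t ht
  · obtain ⟨hco, hli⟩ := hu.weak_continuous w hw
    have heq : ∀ t ∈ Ioc 0 T, ∫ x, ⟪u' t x, w x⟫_ℝ = ∫ x, ⟪u t x, w x⟫_ℝ := fun t ht =>
      integral_inner_congr_ae_left (hae t ⟨ht.1.le, ht.2⟩) w
    refine ⟨hco.congr heq, hli.congr' ?_⟩
    filter_upwards [Ioc_mem_nhdsGT hT] with t ht
    exact (heq t ht).symm
  · refine hu.strong_initial.congr' ?_
    filter_upwards [Ioc_mem_nhdsGT hT] with t ht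
    refine eLpNorm_congr_ae ?_
    filter_upwards [hae t ⟨ht.1.le, ht.2⟩] with x hx
    simp only [Pi.sub_apply, hx]

end LHCongr

end Summit.AnomalousDissipation.AnomalousDissipation.Theorems

end
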